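import Mathlib
import HarnessLib
import Literature.Analysis.FluidPDE.Tao2016AveragedNS.LocalCascadeSolutions
import Literature.Analysis.FluidPDE.Tao2016AveragedNS.RenormalisedCascadeWaves
import Literature.Analysis.FluidPDE.Tao2016AveragedNS.SelfSimilarCascadeBlowup
import Literature.Analysis.FluidPDE.Tao2016AveragedNS.ViscousEternalSolutions
import Literature.Analysis.FluidPDE.Tao2016AveragedNS.BoundedEternalSolutions
import Summits.NavierStokesRegularity.NavierStokesRegularity.Theses.TaoLadderRungTwoBreak
import Summits.NavierStokesRegularity.NavierStokesRegularity.Theorems.TaoLadderRungTwoBreakNoSurvivingEternalViscBddOneSurvivorTailFloor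
import Summits.NavierStokesRegularity.NavierStokesRegularity.Theorems.TaoLadderRungTwoBreakNoSurvivingEternalViscBddOneSurvivorSliceDecay
import Summits.NavierStokesRegularity.NavierStokesRegularity.Theorems.WakeRatchetTailRatchetScalarFrontFloor

/-!
# The `1/ε₀` amplitude floor on the DYADIC MEMBER (`C_A = 1`): survivors of the critical Katz–Pavlović chain are `≳ 0.11/ε₀` tall —
# crux K1ᵛ(1) `TaoLadderRungTwoBreak.NoSurvivingEternalViscBddOne` ⟨20419⟩, the cell's (W1-dyadic) target

MODEL lattice ODEs only (Tao 2016 §1.2/§4: the scalar dyadic member `dyadicTable` of the comparable class, in the self-similar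
variables of §6.4); nothing here is a statement about the Navier–Stokes equations; no stub, crux or summit is closed
(`--supports stmt-NavierStokesRegularity-20419`).

The flux constant of the dyadic table is `C_A = fluxConst dyadicTable = 1` (tree `WakeRatchetScalarFrontFloor.fluxConst_dyadicTable`), so the general floors of
`…SurvivorAmplitudeFloor` / `…SurvivorTailFloor` / `…SurvivorSliceDecay` read, for the (W1-dyadic) objects (uniformly bounded
forward-(S₁)-surviving admissible eternal solutions of the dyadic member, any `ν̂ ≥ 0`), 64× sharper than the class-wide `C_A ≤ 64` form:
* `dyadic_survivor_amplitude_floor` — `4Λ ≤ 7·B·(Λ²−1)`, i.e. `sup‖W‖ ≥ (4/7)Λ/((1+ε₀)⁵−1) ≈ 0.114/ε₀`;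
* `dyadic_survivor_tall_io` — `‖W_k(σ)‖ > Λ/(2(Λ²−1)) ≈ 1/(10ε₀)` on arbitrarily high shells `k`;
* `dyadic_wtEnergy_geometric_decay` — `7B(Λ²−1) < 4Λ ⟹ wtEnergy ≤ C·qⁿ` (`q < 1`), all shells, all log-times;
* `dyadic_noSurviving_onSlice` — for `0 < ε₀ ≤ min 1 (1/(55B))` no admissible eternal solution of the dyadic member with `sup‖W‖ ≤ B`
  is (S₁)-surviving (both (ρ0) `ν̂ = 0` and (ρ+) `ν̂ > 0`).
Together with the tree's dyadic floors (`dyadic_survivor_shell_floor`: `sup_σ W_n ≥ Λ⁻¹` on EVERY shell; critical squaring) this pins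
the (W1-dyadic) enemy: renormalised pulses of height `≳ 0.1/ε₀` recurring on arbitrarily high shells.
HONEST LABEL: (ρ0), (ρ+), ⟨20419⟩, (W1-dyadic) and every NS statement remain OPEN; rung 0.
-/

noncomputable section

-- the summit and its single sub-problem share the name (CONVENTIONS §1)
set_option linter.dupNamespace false

namespace Summit.NavierStokesRegularity.NavierStokesRegularity.Theorems.NoSurvivingEternalViscBddOne.SurvivorFloorDyadic

open Set Filter Topology MeasureTheory
open scoped RealInnerProductSpace
open Literature.Analysis.FluidPDE Literature.Analysis.FluidPDE.TaoCascade
open Summit.NavierStokesRegularity.NavierStokesRegularity.Theses.TaoLadderRungTwoBreak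
open Summit.NavierStokesRegularity.NavierStokesRegularity.Theorems.NoSurvivingEternalViscBddOne.SurvivorAmplitudeFloor
open Summit.NavierStokesRegularity.NavierStokesRegularity.Theorems.NoSurvivingEternalViscBddOne.SurvivorTailFloor
open Summit.NavierStokesRegularity.NavierStokesRegularity.Theorems.NoSurvivingEternalViscBddOne.SurvivorSliceDecay
open Summit.NavierStokesRegularity.NavierStokesRegularity.Theorems.WakeRatchetScalarFrontFloor (fluxConst_dyadicTable)

variable {ε₀ νh : ℝ} {W : ℤ → ℝ → Em 4}

/-- **THE `1/ε₀` AMPLITUDE FLOOR ON THE DYADIC MEMBER.**  A uniformly bounded (`‖W‖ ≤ B`), forward-(S₁)-surviving admissible eternal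
solution (any `ν̂ ≥ 0`) of the dyadic member satisfies `4Λ ≤ 7·B·(Λ²−1)`: `sup‖W‖ ≥ (4/7)Λ/((1+ε₀)⁵−1) ≈ 0.114/ε₀`.
[cite: Tao2016AveragedNS, §1.2, §4 Lemma 4.1 (4.8)–(4.10), §6.4; tree `survivor_amplitude_floor`] -/
theorem dyadic_survivor_amplitude_floor (hε : 0 < ε₀) (hW : IsEternalVisc ε₀ νh dyadicTable W)
    {B : ℝ} (hB : ∀ k σ, ‖W k σ‖ ≤ B) (hS : EternalSurvivingFwd 1 ε₀ W) :
    4 * bigLam ε₀ ≤ 7 * B * (bigLam ε₀ ^ 2 - 1) := by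
  have h := survivor_amplitude_floor hε hW dyadicTable_cancelling hB hS
  rw [fluxConst_dyadicTable] at h
  linarith

/-- **On every tail** of a uniformly bounded survivor of the dyadic member: `‖W_k‖ ≤ B` for `k ≥ n₀` forces `4Λ ≤ 7·B·(Λ²−1)`.
[cite: Tao2016AveragedNS, §1.2, §4, §6.4; tree `survivor_amplitude_floor_tail`] -/
theorem dyadic_survivor_amplitude_floor_tail (hε : 0 < ε₀) (hW : IsEternalVisc ε₀ νh dyadicTable W) (hU : UniformBound W)
    (n₀ : ℕ) {B : ℝ} (hB : ∀ k : ℤ, (n₀ : ℤ) ≤ k → ∀ σ, ‖W k σ‖ ≤ B) (hS : EternalSurvivingFwd 1 ε₀ W) :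
    4 * bigLam ε₀ ≤ 7 * B * (bigLam ε₀ ^ 2 - 1) := by
  have h := survivor_amplitude_floor_tail hε hW dyadicTable_cancelling hU n₀ hB hS
  rw [fluxConst_dyadicTable] at h
  linarith

/-- **Dyadic survivors stay tall**: `‖W_k(σ)‖ > Λ/(2(Λ²−1)) ≈ 1/(10ε₀)` on arbitrarily high shells.
[cite: Tao2016AveragedNS, §1.2, §4, §6.4; this file] -/
theorem dyadic_survivor_tall_io (hε : 0 < ε₀) (hW : IsEternalVisc ε₀ νh dyadicTable W) (hU : UniformBound W)
    (hS : EternalSurvivingFwd 1 ε₀ W) (n₀ : ℕ) :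
    ∃ k : ℤ, (n₀ : ℤ) ≤ k ∧ ∃ σ : ℝ, bigLam ε₀ / (2 * (bigLam ε₀ ^ 2 - 1)) < ‖W k σ‖ := by
  by_contra hno
  push Not at hno
  have hΛ : 0 < bigLam ε₀ := bigLam_pos (by linarith)
  have hΛ1 : 1 < bigLam ε₀ := by unfold bigLam; exact Real.one_lt_rpow (by linarith) (by norm_num)
  have hΛ2 : 0 < bigLam ε₀ ^ 2 - 1 := by nlinarith
  have h := dyadic_survivor_amplitude_floor_tail hε hW hU n₀ (fun k hk σ => hno k hk σ) hS
  have e : 7 * (bigLam ε₀ / (2 * (bigLam ε₀ ^ 2 - 1))) * (bigLam ε₀ ^ 2 - 1) = 7 / 2 * bigLam ε₀ := by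
    field_simp
  rw [e] at h
  linarith

/-- **Geometric decay of the weighted energy below the dyadic floor**: `7·B·(Λ²−1) < 4Λ` ⟹ `wtEnergy ε₀ W n σ ≤ C·qⁿ`, `q < 1`, for all
shells and all log-times.
[cite: Tao2016AveragedNS, §1.2, §4, §6.4; tree `wtEnergy_geometric_decay`] -/
theorem dyadic_wtEnergy_geometric_decay (hε : 0 < ε₀) (hW : IsEternalVisc ε₀ νh dyadicTable W)
    {B : ℝ} (hB : ∀ k σ, ‖W k σ‖ ≤ B) (hlt : 7 * B * (bigLam ε₀ ^ 2 - 1) < 4 * bigLam ε₀) :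
    ∃ C q : ℝ, 0 < C ∧ 0 < q ∧ q < 1 ∧ ∀ (n : ℕ) (σ : ℝ), wtEnergy ε₀ W n σ ≤ C * q ^ n := by
  refine wtEnergy_le_geometric hε hW dyadicTable_cancelling hB ?_
  rw [fluxConst_dyadicTable]; linarith

/-- `(1+ε)⁵ − 1 ≤ 31ε` on `[0,1]`. [folklore] -/
private theorem pow_five_sub_one_le_d {ε : ℝ} (h0 : 0 ≤ ε) (h1 : ε ≤ 1) : (1 + ε) ^ 5 - 1 ≤ 31 * ε := by
  have h2 : ε ^ 2 ≤ ε := by nlinarith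
  have h3 : ε ^ 3 ≤ ε := by nlinarith
  have h4 : ε ^ 4 ≤ ε := by nlinarith
  have h5 : ε ^ 5 ≤ ε := by nlinarith
  nlinarith

/-- **(W1-dyadic) ON EVERY BOUNDED-AMPLITUDE SLICE.**  For `B > 0` and ALL `0 < ε₀ ≤ min 1 (1/(55B))`, every `ν̂ ≥ 0`: no admissible
eternal solution of the dyadic member with `sup‖W‖ ≤ B` is forward (S₁)-surviving (both (ρ0) and (ρ+) on the dyadic member, on the
slice).  The (W1-dyadic) statement of the census is this with a `B`-independent threshold.
[cite: Tao2016AveragedNS, §1.2, §4 Thm. 4.2 (statement shape), §6.4; this file] -/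
theorem dyadic_noSurviving_onSlice {B : ℝ} (hBpos : 0 < B) :
    ∀ ε₀ : ℝ, 0 < ε₀ → ε₀ ≤ min 1 (1 / (55 * B)) →
      ∀ (νh : ℝ) (W : ℤ → ℝ → Em 4), IsEternalVisc ε₀ νh dyadicTable W → (∀ k σ, ‖W k σ‖ ≤ B) →
        ¬ EternalSurvivingFwd 1 ε₀ W := by
  intro ε₀ hε hle νh W hW hB hS
  have hε1 : ε₀ ≤ 1 := hle.trans (min_le_left _ _)
  have hεB : ε₀ ≤ 1 / (55 * B) := hle.trans (min_le_right _ _)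
  have hΛ1 : 1 ≤ bigLam ε₀ := one_le_bigLam hε.le
  have h := dyadic_survivor_amplitude_floor hε hW hB hS
  rw [bigLam_sq hε.le] at h
  have h1 : (1 + ε₀) ^ 5 - 1 ≤ 31 * ε₀ := pow_five_sub_one_le_d hε.le hε1
  have h2 : 7 * B * ((1 + ε₀) ^ 5 - 1) ≤ 7 * B * (31 * ε₀) := mul_le_mul_of_nonneg_left h1 (by positivity)
  have h3 : 55 * B * ε₀ ≤ 1 := by
    rw [le_div_iff₀ (by positivity)] at hεB
    linarith
  nlinarith

end Summit.NavierStokesRegularity.NavierStokesRegularity.Theorems.NoSurvivingEternalViscBddOne.SurvivorFloorDyadic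

end
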